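import Summits.CriticalPhenomena.Ising3DConformalLimit.Theses.LatticeSDPCertificates
import Literature.Probability.LatticeModels.PointwiseScalingLimitEtaExists
import Literature.Probability.LatticeModels.SharpnessSubcritical

/-!
# `WindowGivesDoubling` — WINDOW along the axis implies all-scale doubling

Route `route-CriticalPhenomena-LatticeSDPCertificates`, item `stmt-CriticalPhenomena-5508`.

Write `G = criticalTwoPoint 3` for the critical plus-state two-point function on `ℤ³`.
WINDOW is the axial scale comparison `c (n/m)^{-(3/2-ε)} G(m e₁) ≤ G(n e₁)` for `1 ≤ m ≤ n`.
Doubling is `κ G(x) ≤ G(2x)` for all `x ≠ 0` with one `κ > 0`.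

Proof.  Let `n = ‖x‖_∞ ≥ 1`.  The Messager–Miracle-Solé sphere sandwich
(`criticalTwoPoint_axis_sandwich`) gives `G(x) ≤ G(n e₁)` and, since `‖2x‖_∞ = 2n`,
`G(6n e₁) = G(3·(2n) e₁) ≤ G(2x)`.  WINDOW between the scales `n` and `6n` gives
`c · 6^{-(3/2-ε)} G(n e₁) ≤ G(6n e₁)`.  Hence `κ = c · 6^{-(3/2-ε)}` works.
-/

namespace Summit.CriticalPhenomena.Ising3DConformalLimit.Theorems

open Literature.Probability.LatticeModels
open Summit.CriticalPhenomena.Ising3DConformalLimit.Theses.LatticeSDPCertificates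

/-- `‖2 • x‖_∞ = 2 ‖x‖_∞` on `ℤ³` (both inequalities are tree lemmas). -/
theorem supNorm_two_nsmul (x : Site 3) : Site.supNorm (2 • x) = 2 * Site.supNorm x :=
  le_antisymm (Site.supNorm_nsmul_le 2 x) (Site.mul_supNorm_le_supNorm_nsmul 2 x)

/-- **Support item `stmt-CriticalPhenomena-5508`.**  WINDOW for the axial critical two-point
function on `ℤ³` implies all-scale doubling `κ G(x) ≤ G(2x)` (`x ≠ 0`), with
`κ = c · 6^{-(3/2-ε)}`: MMS sphere sandwich `G(3‖y‖_∞ e₁) ≤ G(y) ≤ G(‖y‖_∞ e₁)` at `y = x`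
and `y = 2x`, and WINDOW between the scales `‖x‖_∞` and `6‖x‖_∞`. -/
theorem windowGivesDoubling_proof :
    Summit.CriticalPhenomena.Ising3DConformalLimit.Theses.LatticeSDPCertificates.WindowGivesDoubling := by
  unfold WindowGivesDoubling
  rintro ⟨ε, c, _hε, hc, hW⟩
  have hκ : 0 < c * (6:ℝ) ^ (-((3:ℝ) / 2 - ε)) :=
    mul_pos hc (Real.rpow_pos_of_pos (by norm_num) _)
  refine ⟨c * (6:ℝ) ^ (-((3:ℝ) / 2 - ε)), hκ, fun x hx => ?_⟩
  -- `n = ‖x‖_∞ ≥ 1`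
  obtain ⟨n, hn⟩ : ∃ n : ℕ, Site.supNorm x = n := ⟨_, rfl⟩
  have hn1 : 1 ≤ n := by
    rw [← hn]
    exact Nat.one_le_iff_ne_zero.2 fun h => hx (Site.supNorm_eq_zero_iff.1 h)
  have h2n : Site.supNorm (2 • x) = 2 * n := by rw [supNorm_two_nsmul, hn]
  have h2n1 : 1 ≤ Site.supNorm (2 • x) := by rw [h2n]; omega
  -- MMS sphere sandwich: `G x ≤ G (n e₁)` and `G (6n e₁) ≤ G (2x)`
  have hup : criticalTwoPoint 3 x ≤ criticalTwoPoint 3 (Pi.single 0 (n : ℤ)) := by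
    have h := (criticalTwoPoint_axis_sandwich (le_of_le_of_eq hn1 hn.symm)).2
    rwa [hn] at h
  have hlo : criticalTwoPoint 3 (Pi.single 0 ((6 * n : ℕ) : ℤ)) ≤ criticalTwoPoint 3 (2 • x) := by
    have h := (criticalTwoPoint_axis_sandwich h2n1).1
    have h36 : 3 * Site.supNorm (2 • x) = 6 * n := by rw [h2n]; ring
    rwa [h36] at h
  -- WINDOW between the scales `n` and `6 n`
  have hW' := hW n (6 * n) hn1 (by omega)
  have h6 : (((6 * n : ℕ) : ℝ) / (n : ℝ)) = 6 := by
    have hn0 : (n : ℝ) ≠ 0 := by exact_mod_cast (Nat.one_le_iff_ne_zero.1 hn1)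
    push_cast
    field_simp
  rw [h6] at hW'
  calc c * (6:ℝ) ^ (-((3:ℝ) / 2 - ε)) * criticalTwoPoint 3 x
      ≤ c * (6:ℝ) ^ (-((3:ℝ) / 2 - ε)) * criticalTwoPoint 3 (Pi.single 0 (n : ℤ)) :=
        mul_le_mul_of_nonneg_left hup hκ.le
    _ ≤ criticalTwoPoint 3 (Pi.single 0 ((6 * n : ℕ) : ℤ)) := hW'
    _ ≤ criticalTwoPoint 3 (2 • x) := hlo

end Summit.CriticalPhenomena.Ising3DConformalLimit.Theorems
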